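import Literature.AlgebraicGeometry.HodgeTheory.SymmetricA3SliceReduction
import HarnessLib

/-!
# The symmetric `A₃` point: jets along the kernel line (the `A₃` condition `∂ₖ⁴f₁(e_j) ≠ 0` at work)
# (programme B2-BIF, stage S3a, for the binder hB2 `picardLefschetz_symmetricA3` of crux K1-B)

Family `hodge`, layer `Literature/AlgebraicGeometry/HodgeTheory`, sequel of `SymmetricA3SliceReduction` (S0–S1) and
companion of `SymmetricA3ReducedChart` (S2).  Written by the prover seat `hodge-nonav-prover-Bx` (g12, cell
`hodge-nonav`), programme memo `HOME/memos/PROGRAMME-B2BIF-Bx-g12.md`.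

CHART-FREE one-variable jet computations at the symmetric `A₃` point `e_j` of `IsSymmetricA3Datum f₁ g₀ g₂ j k a`.
Let `c ∈ ℂ` and let `y : ℂ → ℂⁿ⁺²` be analytic at `0` with `y(0) = e_j` and, for `t` near `0`, `y(t)_j = 1`,
`y(t)_k = t` and `∂ᵢ(f₁ + c t · g₂)(y(t)) = 0` for `i ∉ {j, k}` (the slice-critical curve of the reduced chart
along the line `(α, β, u) = (c t, 0, t)`).  Then:

* `IsSymmetricA3Datum.kernelLine_deriv_zero` — `y'(0) = e_k` (differentiate the constraints: `Hess(f₁)(e_j) · y'(0) = 0`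
  off the rows `j, k` because `∂ᵢg₂(e_j) = 0`, on those rows by Euler and the datum; the Hessian is injective on
  `{v_j = v_k = 0}`);
* `IsSymmetricA3Datum.kernelLine_jets` — for `B(t) = ∂ₖf₁(y(t))` and `C(t) = ∂ₖg₂(y(t))`: `B'(0) = 0`, `B''(0) = 0`
  (no cubic term `∂ᵢ∂ₖ∂ₖf₁(e_j) = 0`), `B'''(0) = c₄ := ∂ₖ⁴f₁(e_j)`, `C(0) = 0`, `C'(0) = κ := ∂ₖ∂ₖg₂(e_j)`;
* `IsSymmetricA3Datum.kernelLine_lambda_jets` — for `λ(t) = ∂ₖ(f₁ + c t g₂)(y(t)) = B + c t C`: `λ(0) = λ'(0) = 0`,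
  `λ''(0) = 2 c κ`;
* `IsSymmetricA3Datum.kernelLine_reduced_jets`, `…_reduced_order_two` — if `λ(t) = t · σ(t)` with `σ` analytic at `0`
  (the reduced `∂ₖ`-partial `s` of S2 along the line), then `σ(0) = 0`, `σ'(0) = c κ`; and for `c = 0`:
  `3 σ''(0) = c₄ ≠ 0`, so `σ` has a zero of order EXACTLY two at `0` — the two off-axis critical points `u = ±u₀` of the
  `A₃` unfolding (AGZV II §5.2: `B₂`, level bifurcation set `λ₂ = 0 ∪ λ₁² = 4λ₂`).

## References
* [ArnoldGuseinzadeVarchenko2012] AGZV II, Part I §5.2 (boundary singularities `B_k`, pp. 129–133); Part I §2.9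
  (the `A₃` normal form `u⁴ + Q(v)`).
-/

noncomputable section

open MvPolynomial
open _root_.Topology _root_.Filter Set
open Literature.NumberTheory.Transcendental (hasFDerivAt_eval)

namespace Literature.AlgebraicGeometry.HodgeTheory

section HodgeTheory

variable {n d : ℕ} {f₁ g₀ g₂ : MvPolynomial (Fin (n + 2)) ℂ} {j k : Fin (n + 2)} {a : Fin (n + 2) → ℂˣ}

namespace IsSymmetricA3Datum

open DiscriminantBranches

/-! ### §1 Toolkit: polynomials along an analytic curve -/

/-- Chain rule: `d/dt Q(y(t)) = Σ_m ∂_mQ(y(t)) · y_m'(t)`. [folklore] -/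
private theorem hasDerivAt_eval_curve {y : ℂ → (Fin (n + 2) → ℂ)} {t : ℂ} (hy : DifferentiableAt ℂ y t)
    (Q : MvPolynomial (Fin (n + 2)) ℂ) :
    HasDerivAt (fun t => eval (y t) Q) (∑ m, eval (y t) (pderiv m Q) * deriv (fun t => y t m) t) t := by
  have h1 : HasDerivAt y (deriv y t) t := hy.hasDerivAt
  have h2 : HasDerivAt (fun t => eval (y t) Q)
      ((∑ m, eval (y t) (pderiv m Q) • (ContinuousLinearMap.proj m : (Fin (n + 2) → ℂ) →L[ℂ] ℂ)) (deriv y t)) t := by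
    have h := (hasFDerivAt_eval Q (y t)).comp_hasDerivAt t h1
    exact h
  refine h2.congr_deriv ?_
  rw [deriv_pi fun m => differentiableAt_pi.1 hy m]
  simp only [FunLike.coe_sum, Finset.sum_apply, FunLike.coe_smul, Pi.smul_apply, ContinuousLinearMap.proj_apply,
    smul_eq_mul]

/-- `Q(y(t))` is analytic where `y` is. [folklore] -/
private theorem analyticAt_eval_curve {y : ℂ → (Fin (n + 2) → ℂ)} {t : ℂ} (hy : AnalyticAt ℂ y t)
    (Q : MvPolynomial (Fin (n + 2)) ℂ) : AnalyticAt ℂ (fun t => eval (y t) Q) t :=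
  ((AnalyticOnNhd.eval_mvPolynomial Q) (y t) (mem_univ _)).comp hy

/-- The coordinates of an analytic curve are analytic. [folklore] -/
private theorem analyticAt_coord {y : ℂ → (Fin (n + 2) → ℂ)} {t : ℂ} (hy : AnalyticAt ℂ y t) (m : Fin (n + 2)) :
    AnalyticAt ℂ (fun t => y t m) t :=
  ((ContinuousLinearMap.proj m : (Fin (n + 2) → ℂ) →L[ℂ] ℂ).analyticAt _).comp hy

/-- Leibniz for a finite sum of products, at a point. [folklore] -/
private theorem deriv_sum_mul {ι : Type*} [Fintype ι] {F G : ι → ℂ → ℂ} {x : ℂ}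
    (hF : ∀ m, DifferentiableAt ℂ (F m) x) (hG : ∀ m, DifferentiableAt ℂ (G m) x) :
    deriv (fun t => ∑ m, F m t * G m t) x = ∑ m, (deriv (F m) x * G m x + F m x * deriv (G m) x) := by
  rw [deriv_fun_sum (fun m _ => (hF m).fun_mul (hG m))]
  exact Finset.sum_congr rfl fun m _ => deriv_fun_mul (hF m) (hG m)

/-- Leibniz for a finite sum of products, with prescribed derivatives. [folklore] -/
private theorem hasDerivAt_sum_mul {ι : Type*} [Fintype ι] {F G : ι → ℂ → ℂ} {F' G' : ι → ℂ} {x : ℂ}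
    (hF : ∀ m, HasDerivAt (F m) (F' m) x) (hG : ∀ m, HasDerivAt (G m) (G' m) x) :
    HasDerivAt (fun t => ∑ m, F m t * G m t) (∑ m, (F' m * G m x + F m x * G' m)) x :=
  HasDerivAt.fun_sum fun m _ => (hF m).fun_mul (hG m)

/-- Partial derivatives commute (at the level of values). [folklore] -/
private theorem eval_pderiv_comm (P : MvPolynomial (Fin (n + 2)) ℂ) (p : Fin (n + 2) → ℂ) (i i' : Fin (n + 2)) :
    eval p (pderiv i (pderiv i' P)) = eval p (pderiv i' (pderiv i P)) := by
  have := hessianAt_comm P p i i'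
  simpa [hessianAt] using this

/-! ### §2 The first jet of the slice-critical curve: `y'(0) = e_k` -/

/-- **The slice-critical curve leaves `e_j` in the kernel direction**: if `y` is analytic at `0`, `y(0) = e_j`,
and near `0`: `y(t)_j = 1`, `y(t)_k = t`, `∂ᵢ(f₁ + c t g₂)(y(t)) = 0 (i ∉ {j, k})`, then `y_m'(0) = δ_{mk}`.
[cite: ArnoldGuseinzadeVarchenko2012, Part I §5.2] -/
theorem kernelLine_deriv_zero (hf₁ : f₁.IsHomogeneous d) (hD : IsSymmetricA3Datum f₁ g₀ g₂ j k a) (c : ℂ)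
    {y : ℂ → (Fin (n + 2) → ℂ)} (hy : AnalyticAt ℂ y 0) (hy0 : y 0 = Pi.single j 1)
    (hyc : ∀ᶠ t in 𝓝 0, y t j = 1 ∧ y t k = t ∧
      ∀ i, i ≠ j → i ≠ k → eval (y t) (pderiv i (f₁ + (c * t) • g₂)) = 0) (m : Fin (n + 2)) :
    deriv (fun t => y t m) 0 = (Pi.single k (1 : ℂ) : Fin (n + 2) → ℂ) m := by
  classical
  have hjk : j ≠ k := hD.1
  -- the derivative vector `v` and its `j`, `k` coordinates
  set v : Fin (n + 2) → ℂ := fun m => deriv (fun t => y t m) 0 with hv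
  have hvj : v j = 0 := by
    have h : (fun t => y t j) =ᶠ[𝓝 0] fun _ => (1 : ℂ) := hyc.mono fun t ht => ht.1
    change deriv (fun t => y t j) 0 = 0
    rw [h.deriv_eq, deriv_const]
  have hvk : v k = 1 := by
    have h : (fun t => y t k) =ᶠ[𝓝 0] fun t => t := hyc.mono fun t ht => ht.2.1
    change deriv (fun t => y t k) 0 = 1
    rw [h.deriv_eq, deriv_id'']
  -- differentiating the constraints: `Σ_l ∂ᵢ∂_l f₁(e_j) v_l = 0` for `i ∉ {j, k}`
  have hrow : ∀ i, i ≠ j → i ≠ k → ∑ l, eval (Pi.single j (1 : ℂ)) (pderiv i (pderiv l f₁)) * v l = 0 := by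
    intro i hij hik
    have hE : (fun t => eval (y t) (pderiv i f₁) + (c * t) * eval (y t) (pderiv i g₂)) =ᶠ[𝓝 0] fun _ => (0 : ℂ) := by
      refine hyc.mono fun t ht => ?_
      have := ht.2.2 i hij hik
      rwa [map_add, (pderiv i).map_smul, eval_add, smul_eval] at this
    have hd1 : HasDerivAt (fun t => eval (y t) (pderiv i f₁))
        (∑ l, eval (y 0) (pderiv l (pderiv i f₁)) * v l) 0 := hasDerivAt_eval_curve hy.differentiableAt _
    have hd2 : HasDerivAt (fun t : ℂ => (c * t) * eval (y t) (pderiv i g₂))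
        (c * eval (y 0) (pderiv i g₂) + (c * 0) * deriv (fun t => eval (y t) (pderiv i g₂)) 0) 0 :=
      (by simpa using (hasDerivAt_id (0 : ℂ)).const_mul c : HasDerivAt (fun t : ℂ => c * t) c 0).fun_mul
        (analyticAt_eval_curve hy _).differentiableAt.hasDerivAt
    have h0 := (hd1.fun_add hd2).deriv
    rw [hE.deriv_eq, deriv_const] at h0
    rw [hy0, hD.2.2.2.2.2.2.2.2.2.1 i] at h0
    simp only [mul_zero, zero_mul, add_zero] at h0
    calc ∑ l, eval (Pi.single j (1 : ℂ)) (pderiv i (pderiv l f₁)) * v l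
        = ∑ l, eval (Pi.single j (1 : ℂ)) (pderiv l (pderiv i f₁)) * v l :=
          Finset.sum_congr rfl fun l _ => by rw [eval_pderiv_comm]
      _ = 0 := h0.symm
  -- rows `j` and `k` of the Hessian vanish, and column `k`
  have hHj : ∀ l, eval (Pi.single j (1 : ℂ)) (pderiv j (pderiv l f₁)) = 0 := by
    intro l
    have := congr_fun (hD.hessianAt_mulVec_single_j hf₁) l
    simp only [Matrix.mulVec, dotProduct, hessianAt, Matrix.of_apply, Pi.single_apply, mul_ite, mul_one, mul_zero,
      Finset.sum_ite_eq', Finset.mem_univ, if_true, Pi.zero_apply] at this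
    rw [eval_pderiv_comm]; exact this
  have hHk : ∀ l, eval (Pi.single j (1 : ℂ)) (pderiv l (pderiv k f₁)) = 0 := hD.2.2.2.2.1
  -- `w = v - e_k` is killed by the Hessian and has `w_j = w_k = 0`
  have hw : (fun m => v m - (Pi.single k (1 : ℂ) : Fin (n + 2) → ℂ) m) = 0 := by
    refine hD.eq_zero_of_sum_hessian_mul_eq_zero hf₁ (v := fun m => v m - (Pi.single k (1 : ℂ) : Fin (n + 2) → ℂ) m)
      (by simp [hvj, Pi.single_eq_of_ne hjk]) (by simp [hvk]) fun i => ?_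
    simp only [mul_sub, Finset.sum_sub_distrib, Pi.single_apply, mul_ite, mul_one, mul_zero, Finset.sum_ite_eq',
      Finset.mem_univ, if_true]
    rw [hHk i, sub_zero]
    by_cases hij : i = j
    · rw [hij]; exact Finset.sum_eq_zero fun l _ => by rw [hHj l, zero_mul]
    by_cases hik : i = k
    · rw [hik]; exact Finset.sum_eq_zero fun l _ => by rw [eval_pderiv_comm, hHk l, zero_mul]
    exact hrow i hij hik
  have := congr_fun hw m
  simp only [Pi.zero_apply, sub_eq_zero] at this
  exact this

/-! ### §3 Second and third jets of `∂ₖf₁` and `∂ₖg₂` along the curve -/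

/-- **Jets of the partials along the slice-critical curve.**  With `y` as in `kernelLine_deriv_zero`, the functions
`B(t) = ∂ₖf₁(y(t))` and `C(t) = ∂ₖg₂(y(t))` satisfy `B'(0) = 0`, `B''(0) = 0`, `B'''(0) = ∂ₖ⁴f₁(e_j)`, `C(0) = 0`,
`C'(0) = ∂ₖ∂ₖg₂(e_j)` (the datum kills every other term of the chain rule: `∂ᵢ∂ₖf₁(e_j) = 0`,
`∂ᵢ∂ₖ∂ₖf₁(e_j) = 0`, `∂ₖg₂(e_j) = 0`, and `y'(0) = e_k`). [cite: ArnoldGuseinzadeVarchenko2012, Part I §5.2] -/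
theorem kernelLine_jets (hf₁ : f₁.IsHomogeneous d) (hD : IsSymmetricA3Datum f₁ g₀ g₂ j k a) (c : ℂ)
    {y : ℂ → (Fin (n + 2) → ℂ)} (hy : AnalyticAt ℂ y 0) (hy0 : y 0 = Pi.single j 1)
    (hyc : ∀ᶠ t in 𝓝 0, y t j = 1 ∧ y t k = t ∧
      ∀ i, i ≠ j → i ≠ k → eval (y t) (pderiv i (f₁ + (c * t) • g₂)) = 0) :
    deriv (fun t => eval (y t) (pderiv k f₁)) 0 = 0 ∧
    deriv (deriv (fun t => eval (y t) (pderiv k f₁))) 0 = 0 ∧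
    deriv (deriv (deriv (fun t => eval (y t) (pderiv k f₁)))) 0 =
      eval (Pi.single j (1 : ℂ)) (pderiv k (pderiv k (pderiv k (pderiv k f₁)))) ∧
    eval (y 0) (pderiv k g₂) = 0 ∧
    deriv (fun t => eval (y t) (pderiv k g₂)) 0 = eval (Pi.single j (1 : ℂ)) (pderiv k (pderiv k g₂)) := by
  classical
  have hv : ∀ m, deriv (fun t => y t m) 0 = (Pi.single k (1 : ℂ) : Fin (n + 2) → ℂ) m :=
    hD.kernelLine_deriv_zero hf₁ c hy hy0 hyc
  -- notation: `E Q t = Q(y t)`, `Y1 m = y_m'`, `Y2 m = y_m''`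
  obtain ⟨E, hE⟩ : ∃ E : MvPolynomial (Fin (n + 2)) ℂ → ℂ → ℂ, ∀ Q t, E Q t = eval (y t) Q := ⟨_, fun _ _ => rfl⟩
  obtain ⟨Y1, hY1⟩ : ∃ Y1 : Fin (n + 2) → ℂ → ℂ, ∀ m, Y1 m = deriv (fun t => y t m) := ⟨_, fun _ => rfl⟩
  have hEfun : ∀ Q, E Q = fun t => eval (y t) Q := fun Q => funext (hE Q)
  have hya : ∀ᶠ t in 𝓝 0, AnalyticAt ℂ y t := hy.eventually_analyticAt
  have hEa : ∀ Q, ∀ᶠ t in 𝓝 0, AnalyticAt ℂ (E Q) t := fun Q =>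
    hya.mono fun t ht => by rw [hEfun]; exact analyticAt_eval_curve ht Q
  have hEa0 : ∀ Q, AnalyticAt ℂ (E Q) 0 := fun Q => (hEa Q).self_of_nhds
  have hY1a : ∀ m, ∀ᶠ t in 𝓝 0, AnalyticAt ℂ (Y1 m) t := fun m =>
    hya.mono fun t ht => by rw [hY1]; exact (analyticAt_coord ht m).deriv
  have hY1a0 : ∀ m, AnalyticAt ℂ (Y1 m) 0 := fun m => (hY1a m).self_of_nhds
  have hE0 : ∀ Q, E Q 0 = eval (Pi.single j (1 : ℂ)) Q := fun Q => by rw [hE, hy0]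
  have hY10 : ∀ m, Y1 m 0 = (Pi.single k (1 : ℂ) : Fin (n + 2) → ℂ) m := fun m => by rw [hY1]; exact hv m
  -- the chain rule, near `0` and at `0`
  have hEd : ∀ Q, ∀ᶠ t in 𝓝 0, HasDerivAt (E Q) (∑ m, E (pderiv m Q) t * Y1 m t) t := fun Q =>
    hya.mono fun t ht => by
      have h := hasDerivAt_eval_curve ht.differentiableAt Q
      rw [hEfun]
      refine h.congr_deriv (Finset.sum_congr rfl fun m _ => ?_)
      rw [hE, hY1]
  have hEd' : ∀ Q, deriv (E Q) =ᶠ[𝓝 0] fun t => ∑ m, E (pderiv m Q) t * Y1 m t := fun Q =>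
    (hEd Q).mono fun t ht => ht.deriv
  -- a sum against `y'(0) = e_k` picks the `k`-th term
  have hpick : ∀ φ : Fin (n + 2) → ℂ, ∑ m, φ m * Y1 m 0 = φ k := by
    intro φ
    simp only [hY10, Pi.single_apply, mul_ite, mul_one, mul_zero, Finset.sum_ite_eq', Finset.mem_univ, if_true]
  have hEd0 : ∀ Q, deriv (E Q) 0 = eval (Pi.single j (1 : ℂ)) (pderiv k Q) := fun Q => by
    rw [(hEd Q).self_of_nhds.deriv, hpick, hE0]
  -- the datum
  have hHk : ∀ l, eval (Pi.single j (1 : ℂ)) (pderiv l (pderiv k f₁)) = 0 := hD.2.2.2.2.1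
  have hTk : ∀ l, eval (Pi.single j (1 : ℂ)) (pderiv l (pderiv k (pderiv k f₁))) = 0 := hD.2.2.2.2.2.1
  have hTk' : ∀ l, eval (Pi.single j (1 : ℂ)) (pderiv k (pderiv l (pderiv k f₁))) = 0 := fun l => by
    rw [eval_pderiv_comm]; exact hTk l
  refine ⟨?_, ?_, ?_, ?_, ?_⟩
  · -- `B'(0) = ∂ₖ∂ₖf₁(e_j) = 0`
    rw [← hEfun, hEd0]; exact hHk k
  · -- `B''(0) = ∂ₖ³f₁(e_j) + Σ_m ∂_m∂ₖf₁(e_j) y_m''(0) = 0`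
    rw [← hEfun, (hEd' _).deriv_eq, deriv_sum_mul (fun m => (hEa0 _).differentiableAt)
      (fun m => (hY1a0 m).differentiableAt)]
    refine Finset.sum_eq_zero fun m _ => ?_
    rw [hEd0, hTk' m, hE0, hHk m, zero_mul, zero_mul, add_zero]
  · -- `B'''(0) = ∂ₖ⁴f₁(e_j)`
    -- `B' = A` near `0`, with `A = Σ_m E(∂_m∂_k f₁) · Y1 m`; `A' = A2` near `0`
    have hA : deriv (deriv (E (pderiv k f₁))) =ᶠ[𝓝 0]
        deriv (fun t => ∑ m, E (pderiv m (pderiv k f₁)) t * Y1 m t) := (hEd' _).deriv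
    have hA2 : ∀ᶠ t in 𝓝 0, HasDerivAt (fun t => ∑ m, E (pderiv m (pderiv k f₁)) t * Y1 m t)
        (∑ m, ((∑ r, E (pderiv r (pderiv m (pderiv k f₁))) t * Y1 r t) * Y1 m t +
          E (pderiv m (pderiv k f₁)) t * deriv (Y1 m) t)) t := by
      have h1 : ∀ᶠ t in 𝓝 0, ∀ m, HasDerivAt (E (pderiv m (pderiv k f₁)))
          (∑ r, E (pderiv r (pderiv m (pderiv k f₁))) t * Y1 r t) t :=
        (eventually_all.2 fun m => hEd (pderiv m (pderiv k f₁)))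
      have h2 : ∀ᶠ t in 𝓝 0, ∀ m, HasDerivAt (Y1 m) (deriv (Y1 m) t) t :=
        (eventually_all.2 fun m => (hY1a m).mono fun t ht => ht.differentiableAt.hasDerivAt)
      filter_upwards [h1, h2] with t h1t h2t
      exact hasDerivAt_sum_mul (F' := fun m => ∑ r, E (pderiv r (pderiv m (pderiv k f₁))) t * Y1 r t)
        (G' := fun m => deriv (Y1 m) t) h1t h2t
    have hA2' : deriv (fun t => ∑ m, E (pderiv m (pderiv k f₁)) t * Y1 m t) =ᶠ[𝓝 0]
        fun t => ∑ m, ((∑ r, E (pderiv r (pderiv m (pderiv k f₁))) t * Y1 r t) * Y1 m t +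
          E (pderiv m (pderiv k f₁)) t * deriv (Y1 m) t) := hA2.mono fun t ht => ht.deriv
    rw [← hEfun, (hA.trans hA2').deriv_eq]
    -- differentiate the explicit sum at `0`
    have hB1d : ∀ m, DifferentiableAt ℂ (fun t => ∑ r, E (pderiv r (pderiv m (pderiv k f₁))) t * Y1 r t) 0 :=
      fun m => by
        refine DifferentiableAt.fun_sum fun r _ => ?_  -- sums of products of differentiable functions
        exact ((hEa0 _).differentiableAt).fun_mul ((hY1a0 r).differentiableAt)
    have hsplit : (fun t => ∑ m, ((∑ r, E (pderiv r (pderiv m (pderiv k f₁))) t * Y1 r t) * Y1 m t +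
          E (pderiv m (pderiv k f₁)) t * deriv (Y1 m) t)) =
        fun t => (∑ m, (∑ r, E (pderiv r (pderiv m (pderiv k f₁))) t * Y1 r t) * Y1 m t) +
          ∑ m, E (pderiv m (pderiv k f₁)) t * deriv (Y1 m) t := by
      funext t; rw [← Finset.sum_add_distrib]
    rw [hsplit, deriv_fun_add (DifferentiableAt.fun_sum fun m _ => (hB1d m).fun_mul (hY1a0 m).differentiableAt)
      (DifferentiableAt.fun_sum fun m _ => (hEa0 _).differentiableAt.fun_mul (hY1a0 m).deriv.differentiableAt),
      deriv_sum_mul hB1d (fun m => (hY1a0 m).differentiableAt),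
      deriv_sum_mul (fun m => (hEa0 _).differentiableAt) (fun m => (hY1a0 m).deriv.differentiableAt)]
    -- values at `0`
    have hB10 : ∀ m, (∑ r, E (pderiv r (pderiv m (pderiv k f₁))) 0 * Y1 r 0) = 0 := fun m => by
      rw [hpick fun r => E (pderiv r (pderiv m (pderiv k f₁))) 0, hE0]; exact hTk' m
    have hB1d0 : ∀ m, deriv (fun t => ∑ r, E (pderiv r (pderiv m (pderiv k f₁))) t * Y1 r t) 0 =
        eval (Pi.single j (1 : ℂ)) (pderiv k (pderiv k (pderiv m (pderiv k f₁)))) +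
          ∑ r, eval (Pi.single j (1 : ℂ)) (pderiv r (pderiv m (pderiv k f₁))) * deriv (Y1 r) 0 := fun m => by
      rw [deriv_sum_mul (fun r => (hEa0 _).differentiableAt) (fun r => (hY1a0 r).differentiableAt),
        Finset.sum_add_distrib, hpick fun r => deriv (E (pderiv r (pderiv m (pderiv k f₁)))) 0, hEd0]
      congr 1
      exact Finset.sum_congr rfl fun r _ => by rw [hE0]
    have hsecond : ∑ m, (deriv (E (pderiv m (pderiv k f₁))) 0 * deriv (Y1 m) 0 +
        E (pderiv m (pderiv k f₁)) 0 * deriv (deriv (Y1 m)) 0) = 0 := by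
      refine Finset.sum_eq_zero fun m _ => ?_
      rw [hEd0, hTk' m, hE0, hHk m, zero_mul, zero_mul, add_zero]
    rw [hsecond, add_zero]
    have hfirst : ∀ m, deriv (fun t => ∑ r, E (pderiv r (pderiv m (pderiv k f₁))) t * Y1 r t) 0 * Y1 m 0 +
        (∑ r, E (pderiv r (pderiv m (pderiv k f₁))) 0 * Y1 r 0) * deriv (Y1 m) 0 =
        deriv (fun t => ∑ r, E (pderiv r (pderiv m (pderiv k f₁))) t * Y1 r t) 0 * Y1 m 0 := fun m => by
      rw [hB10 m, zero_mul, add_zero]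
    rw [Finset.sum_congr rfl fun m _ => hfirst m,
      hpick fun m => deriv (fun t => ∑ r, E (pderiv r (pderiv m (pderiv k f₁))) t * Y1 r t) 0, hB1d0 k]
    have hrest : ∑ r, eval (Pi.single j (1 : ℂ)) (pderiv r (pderiv k (pderiv k f₁))) * deriv (Y1 r) 0 = 0 :=
      Finset.sum_eq_zero fun r _ => by rw [hTk r, zero_mul]
    rw [hrest, add_zero]
  · -- `C(0) = ∂ₖg₂(e_j) = 0`
    rw [hy0]; exact hD.2.2.2.2.2.2.2.2.2.1 k
  · -- `C'(0) = ∂ₖ∂ₖg₂(e_j)`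
    rw [← hEfun, hEd0]

/-! ### §4 The reduced partial `λ(t) = ∂ₖ(f₁ + c t g₂)(y(t))` and its quotient `σ = λ / t` -/

/-- **Jets of `λ(t) = ∂ₖ(f₁ + c t·g₂)(y(t))`**: `λ(0) = 0`, `λ'(0) = 0`, `λ''(0) = 2 c · ∂ₖ∂ₖg₂(e_j)`.
[cite: ArnoldGuseinzadeVarchenko2012, Part I §5.2] -/
theorem kernelLine_lambda_jets (hf₁ : f₁.IsHomogeneous d) (hD : IsSymmetricA3Datum f₁ g₀ g₂ j k a) (c : ℂ)
    {y : ℂ → (Fin (n + 2) → ℂ)} (hy : AnalyticAt ℂ y 0) (hy0 : y 0 = Pi.single j 1)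
    (hyc : ∀ᶠ t in 𝓝 0, y t j = 1 ∧ y t k = t ∧
      ∀ i, i ≠ j → i ≠ k → eval (y t) (pderiv i (f₁ + (c * t) • g₂)) = 0) :
    eval (y 0) (pderiv k (f₁ + (c * 0) • g₂)) = 0 ∧
    deriv (fun t => eval (y t) (pderiv k (f₁ + (c * t) • g₂))) 0 = 0 ∧
    deriv (deriv (fun t => eval (y t) (pderiv k (f₁ + (c * t) • g₂)))) 0 =
      2 * c * eval (Pi.single j (1 : ℂ)) (pderiv k (pderiv k g₂)) := by
  obtain ⟨hB1, hB2, -, hC0, hC1⟩ := hD.kernelLine_jets hf₁ c hy hy0 hyc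
  have hya : ∀ᶠ t in 𝓝 0, AnalyticAt ℂ y t := hy.eventually_analyticAt
  -- `λ = B + (c t) C`
  have hsplit : (fun t => eval (y t) (pderiv k (f₁ + (c * t) • g₂))) =
      fun t => eval (y t) (pderiv k f₁) + (c * t) * eval (y t) (pderiv k g₂) := by
    funext t; rw [map_add, (pderiv k).map_smul, eval_add, smul_eval]
  have hBa : ∀ᶠ t in 𝓝 0, AnalyticAt ℂ (fun t => eval (y t) (pderiv k f₁)) t :=
    hya.mono fun t ht => analyticAt_eval_curve ht _
  have hCa : ∀ᶠ t in 𝓝 0, AnalyticAt ℂ (fun t => eval (y t) (pderiv k g₂)) t :=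
    hya.mono fun t ht => analyticAt_eval_curve ht _
  have hlin : ∀ t : ℂ, HasDerivAt (fun t : ℂ => c * t) c t := fun t => by
    simpa using (hasDerivAt_id t).const_mul c
  -- the product `(c t) · C(t)`: derivative near `0` and its first two jets at `0`
  have hPd : ∀ᶠ t in 𝓝 0, HasDerivAt (fun t : ℂ => (c * t) * eval (y t) (pderiv k g₂))
      (c * eval (y t) (pderiv k g₂) + (c * t) * deriv (fun t => eval (y t) (pderiv k g₂)) t) t :=
    hCa.mono fun t ht => (hlin t).fun_mul ht.differentiableAt.hasDerivAt
  have hPd' : deriv (fun t : ℂ => (c * t) * eval (y t) (pderiv k g₂)) =ᶠ[𝓝 0]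
      fun t => c * eval (y t) (pderiv k g₂) + (c * t) * deriv (fun t => eval (y t) (pderiv k g₂)) t :=
    hPd.mono fun t ht => ht.deriv
  have hP1 : deriv (fun t : ℂ => (c * t) * eval (y t) (pderiv k g₂)) 0 = 0 := by
    rw [hPd.self_of_nhds.deriv, hC0]
    simp
  have hP2 : deriv (deriv (fun t : ℂ => (c * t) * eval (y t) (pderiv k g₂))) 0 =
      2 * c * eval (Pi.single j (1 : ℂ)) (pderiv k (pderiv k g₂)) := by
    rw [hPd'.deriv_eq]
    have h1 : HasDerivAt (fun t => c * eval (y t) (pderiv k g₂))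
        (c * deriv (fun t => eval (y t) (pderiv k g₂)) 0) 0 :=
      (hCa.self_of_nhds.differentiableAt.hasDerivAt).const_mul c
    have h2 : HasDerivAt (fun t : ℂ => (c * t) * deriv (fun t => eval (y t) (pderiv k g₂)) t)
        (c * deriv (fun t => eval (y t) (pderiv k g₂)) 0 +
          (c * 0) * deriv (deriv (fun t => eval (y t) (pderiv k g₂))) 0) 0 :=
      (hlin 0).fun_mul hCa.self_of_nhds.deriv.differentiableAt.hasDerivAt
    rw [(h1.fun_add h2).deriv, hC1]
    ring
  refine ⟨?_, ?_, ?_⟩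
  · rw [map_add, (pderiv k).map_smul, eval_add, smul_eval, hC0, hy0, hD.eval_pderiv k]
    ring
  · rw [hsplit, deriv_fun_add hBa.self_of_nhds.differentiableAt (hPd.self_of_nhds.differentiableAt), hB1, hP1,
      add_zero]
  · rw [hsplit]
    have hsum : deriv (fun t => eval (y t) (pderiv k f₁) + (c * t) * eval (y t) (pderiv k g₂)) =ᶠ[𝓝 0]
        fun t => deriv (fun t => eval (y t) (pderiv k f₁)) t +
          deriv (fun t : ℂ => (c * t) * eval (y t) (pderiv k g₂)) t := by
      filter_upwards [hBa, hPd] with t hBt hPt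
      exact deriv_fun_add hBt.differentiableAt hPt.differentiableAt
    rw [hsum.deriv_eq, deriv_fun_add hBa.self_of_nhds.deriv.differentiableAt ?_, hB2, hP2, zero_add]
    -- differentiability of `deriv ((c t) C)` at `0`: it agrees near `0` with an analytic function
    have : AnalyticAt ℂ (fun t => c * eval (y t) (pderiv k g₂) +
        (c * t) * deriv (fun t => eval (y t) (pderiv k g₂)) t) 0 := by
      have hC := hCa.self_of_nhds
      have hC' := hC.deriv
      exact (analyticAt_const.fun_mul hC).fun_add ((analyticAt_const.fun_mul analyticAt_id).fun_mul hC')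
    exact (this.differentiableAt).congr_of_eventuallyEq hPd'

/-- Jets of a quotient: if `λ(t) = t · σ(t)` near `0` with `σ` analytic at `0`, then `σ(0) = λ'(0)`,
`2 σ'(0) = λ''(0)` and `3 σ''(0) = λ'''(0)`. [folklore] -/
private theorem jets_of_eq_id_mul {lam σ : ℂ → ℂ} (hσ : AnalyticAt ℂ σ 0) (h : ∀ᶠ t in 𝓝 0, lam t = t * σ t) :
    σ 0 = deriv lam 0 ∧ 2 * deriv σ 0 = deriv (deriv lam) 0 ∧
      3 * deriv (deriv σ) 0 = deriv (deriv (deriv lam)) 0 := by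
  have hσa : ∀ᶠ t in 𝓝 0, AnalyticAt ℂ σ t := hσ.eventually_analyticAt
  have heq : lam =ᶠ[𝓝 0] fun t => t * σ t := h
  -- first derivative near `0`
  have hd1 : ∀ᶠ t in 𝓝 0, HasDerivAt (fun t => t * σ t) (1 * σ t + t * deriv σ t) t :=
    hσa.mono fun t ht => (hasDerivAt_id' t).fun_mul ht.differentiableAt.hasDerivAt
  have hd1' : deriv lam =ᶠ[𝓝 0] fun t => σ t + t * deriv σ t := by
    refine heq.deriv.trans (hd1.mono fun t ht => ?_)
    rw [ht.deriv, one_mul]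
  -- second derivative near `0`
  have hd2 : ∀ᶠ t in 𝓝 0, HasDerivAt (fun t => σ t + t * deriv σ t)
      (deriv σ t + (1 * deriv σ t + t * deriv (deriv σ) t)) t :=
    hσa.mono fun t ht => ht.differentiableAt.hasDerivAt.fun_add
      ((hasDerivAt_id' t).fun_mul ht.deriv.differentiableAt.hasDerivAt)
  have hd2' : deriv (deriv lam) =ᶠ[𝓝 0] fun t => 2 * deriv σ t + t * deriv (deriv σ) t := by
    refine hd1'.deriv.trans (hd2.mono fun t ht => ?_)
    rw [ht.deriv]; ring
  -- third derivative at `0`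
  have hd3 : HasDerivAt (fun t => 2 * deriv σ t + t * deriv (deriv σ) t)
      (2 * deriv (deriv σ) 0 + (1 * deriv (deriv σ) 0 + 0 * deriv (deriv (deriv σ)) 0)) 0 :=
    (hσ.deriv.differentiableAt.hasDerivAt.const_mul 2).fun_add
      ((hasDerivAt_id' (0 : ℂ)).fun_mul hσ.deriv.deriv.differentiableAt.hasDerivAt)
  refine ⟨?_, ?_, ?_⟩
  · rw [hd1'.self_of_nhds]; ring
  · rw [hd2'.self_of_nhds]; ring
  · rw [hd2'.deriv_eq, hd3.deriv]; ring

/-- **Jets of the reduced partial along the kernel line.**  If moreover `∂ₖ(f₁ + c t g₂)(y(t)) = t · σ(t)` near `0`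
with `σ` analytic at `0` (the quotient `s` of stage S2 restricted to the line `(α, β, u) = (c t, 0, t)`), then
`σ(0) = 0` and `σ'(0) = c · ∂ₖ∂ₖg₂(e_j)`. [cite: ArnoldGuseinzadeVarchenko2012, Part I §5.2] -/
theorem kernelLine_reduced_jets (hf₁ : f₁.IsHomogeneous d) (hD : IsSymmetricA3Datum f₁ g₀ g₂ j k a) (c : ℂ)
    {y : ℂ → (Fin (n + 2) → ℂ)} (hy : AnalyticAt ℂ y 0) (hy0 : y 0 = Pi.single j 1)
    (hyc : ∀ᶠ t in 𝓝 0, y t j = 1 ∧ y t k = t ∧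
      ∀ i, i ≠ j → i ≠ k → eval (y t) (pderiv i (f₁ + (c * t) • g₂)) = 0)
    {σ : ℂ → ℂ} (hσ : AnalyticAt ℂ σ 0)
    (hlam : ∀ᶠ t in 𝓝 0, eval (y t) (pderiv k (f₁ + (c * t) • g₂)) = t * σ t) :
    σ 0 = 0 ∧ deriv σ 0 = c * eval (Pi.single j (1 : ℂ)) (pderiv k (pderiv k g₂)) := by
  obtain ⟨-, h1, h2⟩ := hD.kernelLine_lambda_jets hf₁ c hy hy0 hyc
  obtain ⟨j0, j1, -⟩ := jets_of_eq_id_mul hσ hlam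
  refine ⟨by rw [j0, h1], ?_⟩
  have := j1.trans h2
  have h2' : (2 : ℂ) * deriv σ 0 = 2 * (c * eval (Pi.single j (1 : ℂ)) (pderiv k (pderiv k g₂))) := by
    rw [this]; ring
  exact mul_left_cancel₀ two_ne_zero h2'

/-- **The reduced partial on the axis `α = β = 0` has a zero of order exactly two in `u`.**  If
`∂ₖf₁(y(t)) = t · σ(t)` near `0` with `σ` analytic at `0` (the line `c = 0`), then `σ(0) = 0`, `σ'(0) = 0`,
`3 σ''(0) = ∂ₖ⁴f₁(e_j) ≠ 0` and `analyticOrderAt σ 0 = 2`: the `A₃` point splits off exactly two further critical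
points `u = ±u₀` under unfolding. [cite: ArnoldGuseinzadeVarchenko2012, Part I §5.2] -/
theorem kernelLine_reduced_order_two (hf₁ : f₁.IsHomogeneous d) (hD : IsSymmetricA3Datum f₁ g₀ g₂ j k a)
    {y : ℂ → (Fin (n + 2) → ℂ)} (hy : AnalyticAt ℂ y 0) (hy0 : y 0 = Pi.single j 1)
    (hyc : ∀ᶠ t in 𝓝 0, y t j = 1 ∧ y t k = t ∧ ∀ i, i ≠ j → i ≠ k → eval (y t) (pderiv i f₁) = 0)
    {σ : ℂ → ℂ} (hσ : AnalyticAt ℂ σ 0) (hlam : ∀ᶠ t in 𝓝 0, eval (y t) (pderiv k f₁) = t * σ t) :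
    σ 0 = 0 ∧ deriv σ 0 = 0 ∧
      3 * deriv (deriv σ) 0 = eval (Pi.single j (1 : ℂ)) (pderiv k (pderiv k (pderiv k (pderiv k f₁)))) ∧
      analyticOrderAt σ 0 = 2 := by
  have hyc' : ∀ᶠ t in 𝓝 0, y t j = 1 ∧ y t k = t ∧
      ∀ i, i ≠ j → i ≠ k → eval (y t) (pderiv i (f₁ + ((0 : ℂ) * t) • g₂)) = 0 :=
    hyc.mono fun t ht => ⟨ht.1, ht.2.1, fun i hij hik => by rw [zero_mul, zero_smul, add_zero]; exact ht.2.2 i hij hik⟩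
  obtain ⟨h1, h2, h3, -, -⟩ := hD.kernelLine_jets hf₁ 0 hy hy0 hyc'
  obtain ⟨j0, j1, j2⟩ := jets_of_eq_id_mul hσ hlam
  have hσ0 : σ 0 = 0 := by rw [j0, h1]
  have hσ1 : deriv σ 0 = 0 := by
    have := j1.trans h2
    exact (mul_eq_zero.1 this).resolve_left two_ne_zero
  have hσ2 : 3 * deriv (deriv σ) 0 = eval (Pi.single j (1 : ℂ)) (pderiv k (pderiv k (pderiv k (pderiv k f₁)))) :=
    j2.trans h3
  refine ⟨hσ0, hσ1, hσ2, ?_⟩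
  -- order two: peel off two derivatives
  have hne : deriv (deriv σ) 0 ≠ 0 := by
    intro h0
    rw [h0, mul_zero] at hσ2
    exact hD.quartic_ne hσ2.symm
  have e2 : analyticOrderAt (deriv (deriv σ)) 0 = 0 := (hσ.deriv.deriv.analyticOrderAt_eq_zero).2 hne
  have e1 : analyticOrderAt (deriv σ) 0 = 1 := by
    have h := hσ.deriv.analyticOrderAt_deriv_add_one
    have hfun : (fun z => deriv σ z - deriv σ 0) = deriv σ := by funext z; rw [hσ1, sub_zero]
    rw [hfun, e2] at h
    rw [← h]; rfl
  have h := hσ.analyticOrderAt_deriv_add_one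
  have hfun : (fun z => σ z - σ 0) = σ := by funext z; rw [hσ0, sub_zero]
  rw [hfun, e1] at h
  rw [← h]; rfl

end IsSymmetricA3Datum

end HodgeTheory

end Literature.AlgebraicGeometry.HodgeTheory

end
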